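import Summits.HubbardSuperconductivity.HubbardLadder.Bounds.ThermalKuboCurvatureMulti
import Summits.HubbardSuperconductivity.HubbardLadder.Bounds.NumberConservingTrialDirectionCeiling
import Summits.HubbardSuperconductivity.HubbardLadder.Bounds.NumberConservingGaugeFunctionBound
import Summits.HubbardSuperconductivity.HubbardLadder.Bounds.NumberConservingStiffnessCeiling
import HarnessLib

/-!
# Bounds node: the thermal Kubo-curvature (Duhamel) stiffness ceiling for the general
# number-conserving class on any finite hopping graph, every coordinate sector, `T > 0`

HONEST FRAMING: ladder R1–R4 with certified numbers; no claim on H/H₀. This file states BOUNDS FOR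
A MODEL CLASS (no materials claim) and proves them; nothing here is a cited fact.

Cell `pub-hubbard`, unit `pub-hubbard-bounds` (gen 9), `paper/bounds.tex` Theorem 6_T (the `T > 0`
companion of Theorem 6 / `NumberConservingTrialDirectionCeiling.lean`). Setting (= the tree's
`bdgHopping`): `Λ` any finite vertex type, `t : Λ → Λ → ℝ` symmetric (any sign, range, graph),
`d : Λ → Λ → ℝ` antisymmetric (any flux one-form), `V` any Hermitian matrix on the fermionic Fock
space, `H(θd) = T(t e^{iθd}) + V`, `β > 0`, `p` any set of occupation configurations (coordinate
sector) with blocks `X|_p = X.toBlock p p`, `Z_p(X) = Tr e^{−β X|_p}`.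

* `ThermalKuboCurvatureCeilingNumberConserving` (THEOREM, no gauge hypothesis): if
  `β ρ θ² ≤ log Z_p(H(0)) − log Z_p(H(θd))` for `|θ| ≤ θ₀` (`θ₀ > 0`), then
  `Re⟨J_d|_p⟩_{β,p} = 0` and

    `ρ ≤ G₁^β(d) − (β/2) Re (J_d|_p, J_d|_p)_{β,p}`,

  `G₁^β(d) = ½ Σ_{x,y,σ} d_{xy}² (−t_{xy} Re⟨(c†_{xσ}c_{yσ})|_p⟩_{β,p})`,
  `J_d = T(i t d) = Σ_{x,y,σ} i t_{xy} d_{xy} c†_{xσ} c_{yσ}` (the current coupled to `d`),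
  `( , )_{β,p}` the Duhamel two-point function of the Gibbs state of `H(0)|_p` (tree `duhamel`,
  `≥ 0` on the diagonal). This is the finite-volume Kubo formula
  "diamagnetic term minus paramagnetic current response" (Scalapino–White–Zhang §II) as a
  CEILING on every admissible stiffness coefficient, for the whole class.
* `ThermalKuboCurvatureCeilingNumberConservingGauge` (THEOREM): if moreover `V` is invariant under
  every site-phase gauge `W_φ`, the same holds with `d` replaced by `d + dχ` for every `χ : Λ → ℝ`
  (the hypothesis is gauge invariant, the ceiling is not).
* Edge `thermalStiffnessCeilingNumberConserving_of_kubo`: the gauge node implies the landed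
  `ThermalStiffnessCeilingNumberConserving` (`NumberConservingStiffnessCeiling.lean`, bounds.tex
  Thm 4(T>0) for the class), which is the same statement WITHOUT the nonnegative Duhamel term —
  so this file strictly sharpens it.

Proof: the multi-frequency engine `stiffness_le_multi_kin_sub_duhamel`
(`ThermalKuboCurvatureMulti.lean`) on the block `p`, with one frequency `d_{xy}` per hopping
term:
`H(θd) = H(0) + θ J_d + Σ (cos(θd_{xy}) − 1) t_{xy} c†c + Σ (sin(θd_{xy}) − θ d_{xy}) i t_{xy} c†c`
(`toBlock_peierls_eq_line_add_remainder`); the empty block is trivial (all terms vanish); the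
gauge form by `Z_p(W_φᴴ X W_φ) = Z_p(X)`
(`partitionFn_toBlock_conjTranspose_phaseGauge_mul_mul_phaseGauge`).

References: ScalapinoWhiteZhang1993 §II; ParamekantiTrivediRanderia1998 §II–IV;
HazraVermaRanderia2019 eq. (2); DLS1978 §3.
-/

noncomputable section

namespace Summit.HubbardSuperconductivity.HubbardLadder.Bounds

open Matrix Finset Literature.MathematicalPhysics.QuantumLattice
  Literature.MathematicalPhysics.QuantumFieldTheory

open scoped ComplexConjugate ComplexOrder

section Operator

variable {Λ : Type} [LinearOrder Λ] [Fintype Λ]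

/-- Block of a hopping operator as a sum of blocks of single hopping terms. [folklore] -/
theorem toBlock_bdgHopping (τ : Λ → Λ → ℂ) (p : Finset (Orb Λ) → Prop) :
    (bdgHopping τ).toBlock p p =
      ∑ x : Λ, ∑ y : Λ, ∑ σ : Fin 2,
        τ x y • (creation (orb x σ) * annihilation (orb y σ)).toBlock p p := by
  ext a b
  simp only [bdgHopping, toBlock_apply, Matrix.sum_apply, Matrix.smul_apply]

/-- `T(i t sin(θd)) = θ T(i t d) + T(i t (sin(θd) − θd))`. [folklore] -/
theorem bdgHopping_sin_eq_smul_add (t d : Λ → Λ → ℝ) (θ : ℝ) :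
    bdgHopping (fun x y => ((t x y * Real.sin (θ * d x y) : ℝ) : ℂ) * Complex.I) =
      ((θ : ℝ) : ℂ) • bdgHopping (fun x y => ((t x y * d x y : ℝ) : ℂ) * Complex.I) +
        bdgHopping (fun x y =>
          ((t x y * (Real.sin (θ * d x y) - θ * d x y) : ℝ) : ℂ) * Complex.I) := by
  rw [← bdgHopping_smul, ← bdgHopping_add]
  congr 1
  funext x y
  simp only [Pi.add_apply, Pi.smul_apply, smul_eq_mul]
  push_cast
  ring

/-- The Peierls Hamiltonian as base point + tangent line + second-order remainder:
`T(t e^{iθd}) + V = (T(t) + V) + θ T(i t d) + (T(t (cos θd − 1)) + T(i t (sin θd − θd)))`.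
[folklore] -/
theorem bdgHopping_peierls_eq_line_add_remainder (t d : Λ → Λ → ℝ)
    (V : Matrix (Finset (Orb Λ)) (Finset (Orb Λ)) ℂ) (θ : ℝ) :
    (bdgHopping fun x y => (t x y : ℂ) * Complex.exp (((θ * d x y : ℝ) : ℂ) * Complex.I)) + V =
      (bdgHopping (fun x y => (t x y : ℂ)) + V) +
        ((θ : ℝ) : ℂ) • bdgHopping (fun x y => ((t x y * d x y : ℝ) : ℂ) * Complex.I) +
        (bdgHopping (fun x y => ((t x y * (Real.cos (θ * d x y) - 1) : ℝ) : ℂ)) +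
          bdgHopping (fun x y =>
            ((t x y * (Real.sin (θ * d x y) - θ * d x y) : ℝ) : ℂ) * Complex.I)) := by
  rw [bdgHopping_peierls_split, bdgHopping_sin_eq_smul_add]
  abel

/-- The block of the remainder as the multi-frequency sum of the engine (`K_i = t c†c`,
`P_i = i t c†c`, `v_i = d`, one index per hopping term). [folklore] -/
theorem toBlock_remainder_eq_sum (t d : Λ → Λ → ℝ) (θ : ℝ) (p : Finset (Orb Λ) → Prop) :
    (bdgHopping (fun x y => ((t x y * (Real.cos (θ * d x y) - 1) : ℝ) : ℂ)) +
        bdgHopping (fun x y =>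
          ((t x y * (Real.sin (θ * d x y) - θ * d x y) : ℝ) : ℂ) * Complex.I)).toBlock p p =
      ∑ i : Λ × Λ × Fin 2, ((Real.cos (θ * d i.1 i.2.1) - 1 : ℝ) : ℂ) •
          (((t i.1 i.2.1 : ℝ) : ℂ) •
            (creation (orb i.1 i.2.2) * annihilation (orb i.2.1 i.2.2)).toBlock p p) +
        ∑ i : Λ × Λ × Fin 2, ((Real.sin (θ * d i.1 i.2.1) - θ * d i.1 i.2.1 : ℝ) : ℂ) •
          ((((t i.1 i.2.1 : ℝ) : ℂ) * Complex.I) •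
            (creation (orb i.1 i.2.2) * annihilation (orb i.2.1 i.2.2)).toBlock p p) := by
  have hadd : ∀ X Y : Matrix (Finset (Orb Λ)) (Finset (Orb Λ)) ℂ,
      (X + Y).toBlock p p = X.toBlock p p + Y.toBlock p p := fun X Y => by
    ext a b; simp only [toBlock_apply, Matrix.add_apply]
  rw [hadd, toBlock_bdgHopping, toBlock_bdgHopping]
  simp only [Fintype.sum_prod_type, smul_smul]
  congr 1
  · refine sum_congr rfl fun x _ => sum_congr rfl fun y _ => sum_congr rfl fun σ _ => ?_
    congr 1
    push_cast
    ring
  · refine sum_congr rfl fun x _ => sum_congr rfl fun y _ => sum_congr rfl fun σ _ => ?_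
    congr 1
    push_cast
    ring

/-- Block form of `bdgHopping_peierls_eq_line_add_remainder`:
`H(θd)|_p = H(0)|_p + θ J_d|_p + Σ_i (cos(θv_i) − 1) K_i + Σ_i (sin(θv_i) − θv_i) P_i`.
[folklore] -/
theorem toBlock_peierls_eq_line_add_remainder (t d : Λ → Λ → ℝ)
    (V : Matrix (Finset (Orb Λ)) (Finset (Orb Λ)) ℂ) (θ : ℝ) (p : Finset (Orb Λ) → Prop) :
    ((bdgHopping fun x y => (t x y : ℂ) * Complex.exp (((θ * d x y : ℝ) : ℂ) * Complex.I)) +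
        V).toBlock p p =
      (bdgHopping (fun x y => (t x y : ℂ)) + V).toBlock p p +
        ((θ : ℝ) : ℂ) •
          (bdgHopping (fun x y => ((t x y * d x y : ℝ) : ℂ) * Complex.I)).toBlock p p +
        (∑ i : Λ × Λ × Fin 2, ((Real.cos (θ * d i.1 i.2.1) - 1 : ℝ) : ℂ) •
            (((t i.1 i.2.1 : ℝ) : ℂ) •
              (creation (orb i.1 i.2.2) * annihilation (orb i.2.1 i.2.2)).toBlock p p) +
          ∑ i : Λ × Λ × Fin 2, ((Real.sin (θ * d i.1 i.2.1) - θ * d i.1 i.2.1 : ℝ) : ℂ) •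
            ((((t i.1 i.2.1 : ℝ) : ℂ) * Complex.I) •
              (creation (orb i.1 i.2.2) * annihilation (orb i.2.1 i.2.2)).toBlock p p)) := by
  rw [← toBlock_remainder_eq_sum, bdgHopping_peierls_eq_line_add_remainder]
  ext a b
  simp only [toBlock_apply, Matrix.add_apply, Matrix.smul_apply]

/-- The remainder is Hermitian (symmetric `t`, antisymmetric `d`). [folklore] -/
theorem isHermitian_remainder {t d : Λ → Λ → ℝ} (ht : ∀ x y, t y x = t x y)
    (hd : ∀ x y, d y x = -d x y) (θ : ℝ) :
    (bdgHopping (fun x y => ((t x y * (Real.cos (θ * d x y) - 1) : ℝ) : ℂ)) +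
        bdgHopping (fun x y =>
          ((t x y * (Real.sin (θ * d x y) - θ * d x y) : ℝ) : ℂ) * Complex.I)).IsHermitian := by
  refine (isHermitian_bdgHopping_real fun x y => ?_).add (isHermitian_bdgHopping_I fun x y => ?_)
  · rw [ht x y, hd x y, mul_neg, Real.cos_neg]
  · rw [ht x y, hd x y, mul_neg, Real.sin_neg]; ring

/-- The current `J_d = T(i t d)` is Hermitian (symmetric `t`, antisymmetric `d`). [folklore] -/
theorem isHermitian_current {t d : Λ → Λ → ℝ} (ht : ∀ x y, t y x = t x y)
    (hd : ∀ x y, d y x = -d x y) :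
    (bdgHopping fun x y => ((t x y * d x y : ℝ) : ℂ) * Complex.I).IsHermitian :=
  isHermitian_bdgHopping_I fun x y => by rw [ht x y, hd x y, mul_neg]

end Operator

/-! ### The nodes -/

/-- **Node (THEOREM, proved below): thermal Kubo-curvature stiffness ceiling, full
number-conserving class, any finite hopping graph, any coordinate sector, `T > 0`, no gauge
hypothesis.** For symmetric real `t`, antisymmetric `d`, Hermitian `V`, `β > 0`, a coordinate
sector `p`, `θ₀ > 0` and a real `ρ` with `β ρ θ² ≤ log Z_p(H(0)) − log Z_p(H(θd))` for `|θ| ≤ θ₀`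
(`H(θd) = T(t e^{iθd}) + V`): `Re⟨J_d|_p⟩_{β,p} = 0` and
`ρ ≤ Σ_{x,y,σ} d_{xy}² (−t_{xy} Re⟨(c†_{xσ}c_{yσ})|_p⟩_{β,p}) / 2 − (β/2) Re (J_d|_p, J_d|_p)`,
`J_d = T(i t d)`, `( , )` the Duhamel function of the Gibbs state of `H(0)|_p`.
[cite: ScalapinoWhiteZhang1993, §II] [cite: ParamekantiTrivediRanderia1998, §IV] -/
@[conjecture] def ThermalKuboCurvatureCeilingNumberConserving : Prop :=
  ∀ (Λ : Type) [LinearOrder Λ] [Fintype Λ] (t d : Λ → Λ → ℝ), (∀ x y, t y x = t x y) →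
    (∀ x y, d y x = -d x y) → ∀ (V : Matrix (Finset (Orb Λ)) (Finset (Orb Λ)) ℂ), V.IsHermitian →
    ∀ (β : ℝ), 0 < β → ∀ (p : Finset (Orb Λ) → Prop) [Fintype {a // p a}] [DecidableEq {a // p a}]
      (ρ θ₀ : ℝ), 0 < θ₀ →
      (∀ θ : ℝ, |θ| ≤ θ₀ →
        β * (ρ * θ ^ 2) ≤
          Real.log (partitionFn β ((bdgHopping (fun x y => (t x y : ℂ)) + V).toBlock p p)).re -
            Real.log (partitionFn β
              ((bdgHopping (fun x y => (t x y : ℂ) *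
                  Complex.exp (((θ * d x y : ℝ) : ℂ) * Complex.I)) + V).toBlock p p)).re) →
      ρ ≤ (∑ x : Λ, ∑ y : Λ, ∑ σ : Fin 2, d x y ^ 2 *
            (-(t x y * (gibbsState β ((bdgHopping (fun x y => (t x y : ℂ)) + V).toBlock p p)
              ((creation (orb x σ) * annihilation (orb y σ)).toBlock p p)).re) / 2)) -
          β / 2 * (duhamel β ((bdgHopping (fun x y => (t x y : ℂ)) + V).toBlock p p)
            ((bdgHopping fun x y => ((t x y * d x y : ℝ) : ℂ) * Complex.I).toBlock p p)
            ((bdgHopping fun x y => ((t x y * d x y : ℝ) : ℂ) * Complex.I).toBlock p p)).re ∧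
        (gibbsState β ((bdgHopping (fun x y => (t x y : ℂ)) + V).toBlock p p)
          ((bdgHopping fun x y => ((t x y * d x y : ℝ) : ℂ) * Complex.I).toBlock p p)).re = 0

/-- **Node (THEOREM, proved below): gauge form.** Under the hypotheses of
`ThermalKuboCurvatureCeilingNumberConserving` with `V` invariant under every site-phase gauge
`W_φ = phaseGauge (Circle.exp ∘ φ)`, for every `χ : Λ → ℝ` the same conclusion holds with `d`
replaced by `d + dχ`, `(d + dχ)_{xy} = d_{xy} + χ_y − χ_x` (the hypothesis is gauge invariant,
the ceiling is not: minimise over `χ`). [cite: ParamekantiTrivediRanderia1998, §IV]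
[cite: ScalapinoWhiteZhang1993, §II] -/
@[conjecture] def ThermalKuboCurvatureCeilingNumberConservingGauge : Prop :=
  ∀ (Λ : Type) [LinearOrder Λ] [Fintype Λ] (t d : Λ → Λ → ℝ), (∀ x y, t y x = t x y) →
    (∀ x y, d y x = -d x y) → ∀ (V : Matrix (Finset (Orb Λ)) (Finset (Orb Λ)) ℂ), V.IsHermitian →
    (∀ φ : Λ → ℝ, (phaseGauge fun x => Circle.exp (φ x))ᴴ * V *
      phaseGauge (fun x => Circle.exp (φ x)) = V) →
    ∀ (β : ℝ), 0 < β → ∀ (p : Finset (Orb Λ) → Prop) [Fintype {a // p a}] [DecidableEq {a // p a}]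
      (ρ θ₀ : ℝ), 0 < θ₀ →
      (∀ θ : ℝ, |θ| ≤ θ₀ →
        β * (ρ * θ ^ 2) ≤
          Real.log (partitionFn β ((bdgHopping (fun x y => (t x y : ℂ)) + V).toBlock p p)).re -
            Real.log (partitionFn β
              ((bdgHopping (fun x y => (t x y : ℂ) *
                  Complex.exp (((θ * d x y : ℝ) : ℂ) * Complex.I)) + V).toBlock p p)).re) →
      ∀ χ : Λ → ℝ,
      ρ ≤ (∑ x : Λ, ∑ y : Λ, ∑ σ : Fin 2, (d x y + (χ y - χ x)) ^ 2 *
            (-(t x y * (gibbsState β ((bdgHopping (fun x y => (t x y : ℂ)) + V).toBlock p p)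
              ((creation (orb x σ) * annihilation (orb y σ)).toBlock p p)).re) / 2)) -
          β / 2 * (duhamel β ((bdgHopping (fun x y => (t x y : ℂ)) + V).toBlock p p)
            ((bdgHopping fun x y =>
              ((t x y * (d x y + (χ y - χ x)) : ℝ) : ℂ) * Complex.I).toBlock p p)
            ((bdgHopping fun x y =>
              ((t x y * (d x y + (χ y - χ x)) : ℝ) : ℂ) * Complex.I).toBlock p p)).re ∧
        (gibbsState β ((bdgHopping (fun x y => (t x y : ℂ)) + V).toBlock p p)
          ((bdgHopping fun x y =>
            ((t x y * (d x y + (χ y - χ x)) : ℝ) : ℂ) * Complex.I).toBlock p p)).re = 0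

/-! ### Proofs -/

section Proofs

variable {Λ : Type} [LinearOrder Λ] [Fintype Λ]

/-- The engine instantiated: the plain node for one `(Λ, t, d, V, β, p, ρ, θ₀)`. -/
theorem thermalKuboCurvatureCeiling_numberConserving {t d : Λ → Λ → ℝ}
    (ht : ∀ x y, t y x = t x y) (hd : ∀ x y, d y x = -d x y)
    {V : Matrix (Finset (Orb Λ)) (Finset (Orb Λ)) ℂ} (hV : V.IsHermitian) {β : ℝ} (hβ : 0 < β)
    (p : Finset (Orb Λ) → Prop) [Fintype {a // p a}] [DecidableEq {a // p a}] {ρ θ₀ : ℝ}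
    (hθ₀ : 0 < θ₀)
    (hstiff : ∀ θ : ℝ, |θ| ≤ θ₀ →
      β * (ρ * θ ^ 2) ≤
        Real.log (partitionFn β ((bdgHopping (fun x y => (t x y : ℂ)) + V).toBlock p p)).re -
          Real.log (partitionFn β
            ((bdgHopping (fun x y => (t x y : ℂ) *
                Complex.exp (((θ * d x y : ℝ) : ℂ) * Complex.I)) + V).toBlock p p)).re) :
    ρ ≤ (∑ x : Λ, ∑ y : Λ, ∑ σ : Fin 2, d x y ^ 2 *
          (-(t x y * (gibbsState β ((bdgHopping (fun x y => (t x y : ℂ)) + V).toBlock p p)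
            ((creation (orb x σ) * annihilation (orb y σ)).toBlock p p)).re) / 2)) -
        β / 2 * (duhamel β ((bdgHopping (fun x y => (t x y : ℂ)) + V).toBlock p p)
          ((bdgHopping fun x y => ((t x y * d x y : ℝ) : ℂ) * Complex.I).toBlock p p)
          ((bdgHopping fun x y => ((t x y * d x y : ℝ) : ℂ) * Complex.I).toBlock p p)).re ∧
      (gibbsState β ((bdgHopping (fun x y => (t x y : ℂ)) + V).toBlock p p)
        ((bdgHopping fun x y => ((t x y * d x y : ℝ) : ℂ) * Complex.I).toBlock p p)).re = 0 := by
  set Hp := (bdgHopping (fun x y => (t x y : ℂ)) + V).toBlock p p with hHpdef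
  set Jp := (bdgHopping fun x y => ((t x y * d x y : ℝ) : ℂ) * Complex.I).toBlock p p with hJpdef
  rcases isEmpty_or_nonempty {a // p a} with hE | hne
  · -- empty block: all thermal quantities vanish and `ρ ≤ 0`
    have h := hstiff θ₀ (abs_of_pos hθ₀).le
    have h0 : β * (ρ * θ₀ ^ 2) ≤ 0 := by simpa [partitionFn, Matrix.trace] using h
    have hρ : ρ ≤ 0 := by
      by_contra hcon
      push Not at hcon
      have h3 := mul_pos hβ (mul_pos hcon (pow_pos hθ₀ 2))
      linarith
    refine ⟨?_, ?_⟩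
    · simpa [gibbsState_apply, duhamel, partitionFn, Matrix.trace] using hρ
    · simp [gibbsState_apply, Matrix.trace]
  · -- nonempty block: the multi-frequency engine, one frequency per hopping term
    have hHp : Hp.IsHermitian := ((isHermitian_bdgHopping_real ht).add hV).submatrix _
    have hJp : Jp.IsHermitian := (isHermitian_current ht hd).submatrix _
    have hR : ∀ θ : ℝ,
        (∑ i : Λ × Λ × Fin 2, ((Real.cos (θ * d i.1 i.2.1) - 1 : ℝ) : ℂ) •
            (((t i.1 i.2.1 : ℝ) : ℂ) •
              (creation (orb i.1 i.2.2) * annihilation (orb i.2.1 i.2.2)).toBlock p p) +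
          ∑ i : Λ × Λ × Fin 2, ((Real.sin (θ * d i.1 i.2.1) - θ * d i.1 i.2.1 : ℝ) : ℂ) •
            ((((t i.1 i.2.1 : ℝ) : ℂ) * Complex.I) •
              (creation (orb i.1 i.2.2) * annihilation (orb i.2.1 i.2.2)).toBlock p p)
        ).IsHermitian :=
      fun θ => by
        rw [← toBlock_remainder_eq_sum]
        exact (isHermitian_remainder ht hd θ).submatrix _
    have hyp : ∀ θ : ℝ, |θ| ≤ θ₀ → β * ρ * θ ^ 2 ≤ Real.log (partitionFn β Hp).re -
        Real.log (partitionFn β (Hp + ((θ : ℝ) : ℂ) • Jp +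
          (∑ i : Λ × Λ × Fin 2, ((Real.cos (θ * d i.1 i.2.1) - 1 : ℝ) : ℂ) •
              (((t i.1 i.2.1 : ℝ) : ℂ) •
                (creation (orb i.1 i.2.2) * annihilation (orb i.2.1 i.2.2)).toBlock p p) +
            ∑ i : Λ × Λ × Fin 2, ((Real.sin (θ * d i.1 i.2.1) - θ * d i.1 i.2.1 : ℝ) : ℂ) •
              ((((t i.1 i.2.1 : ℝ) : ℂ) * Complex.I) •
                (creation (orb i.1 i.2.2) * annihilation (orb i.2.1 i.2.2)).toBlock p p)))).re := by
      intro θ hθ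
      have h := hstiff θ hθ
      rw [toBlock_peierls_eq_line_add_remainder, ← hHpdef, ← hJpdef, ← mul_assoc] at h
      exact h
    obtain ⟨h1, h2⟩ := stiffness_le_multi_kin_sub_duhamel hHp hJp
      (fun i : Λ × Λ × Fin 2 => ((t i.1 i.2.1 : ℝ) : ℂ) •
        (creation (orb i.1 i.2.2) * annihilation (orb i.2.1 i.2.2)).toBlock p p)
      (fun i : Λ × Λ × Fin 2 => (((t i.1 i.2.1 : ℝ) : ℂ) * Complex.I) •
        (creation (orb i.1 i.2.2) * annihilation (orb i.2.1 i.2.2)).toBlock p p)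
      (fun i : Λ × Λ × Fin 2 => d i.1 i.2.1) hR hβ hθ₀ hyp
    refine ⟨?_, h2⟩
    have hG : -(∑ i : Λ × Λ × Fin 2, d i.1 i.2.1 ^ 2 *
        (gibbsState β Hp (((t i.1 i.2.1 : ℝ) : ℂ) •
          (creation (orb i.1 i.2.2) * annihilation (orb i.2.1 i.2.2)).toBlock p p)).re) / 2 =
        ∑ x : Λ, ∑ y : Λ, ∑ σ : Fin 2, d x y ^ 2 *
          (-(t x y * (gibbsState β Hp
            ((creation (orb x σ) * annihilation (orb y σ)).toBlock p p)).re) / 2) := by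
      rw [show ∀ S : ℝ, -S / 2 = (-1 / 2) * S from fun S => by ring, Finset.mul_sum]
      simp only [Fintype.sum_prod_type, map_smul, smul_eq_mul, Complex.re_ofReal_mul]
      refine sum_congr rfl fun x _ => sum_congr rfl fun y _ => sum_congr rfl fun σ _ => ?_
      ring
    rw [hG] at h1
    exact h1

/-- `ThermalKuboCurvatureCeilingNumberConserving` holds. -/
theorem thermalKuboCurvatureCeilingNumberConserving_holds :
    ThermalKuboCurvatureCeilingNumberConserving := by
  intro Λ _ _ t d ht hd V hV β hβ p _ _ ρ θ₀ hθ₀ hstiff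
  exact thermalKuboCurvatureCeiling_numberConserving ht hd hV hβ p hθ₀ hstiff

/-- `ThermalKuboCurvatureCeilingNumberConservingGauge` holds (gauge the hypothesis to `d + dχ`,
then the plain node). -/
theorem thermalKuboCurvatureCeilingNumberConservingGauge_holds :
    ThermalKuboCurvatureCeilingNumberConservingGauge := by
  intro Λ _ _ t d ht hd V hV hVg β hβ p _ _ ρ θ₀ hθ₀ hstiff χ
  have hd' : ∀ x y, d y x + (χ x - χ y) = -(d x y + (χ y - χ x)) := fun x y => by
    rw [hd x y]; ring
  refine thermalKuboCurvatureCeiling_numberConserving (d := fun x y => d x y + (χ y - χ x))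
    ht hd' hV hβ p hθ₀ fun θ hθ => ?_
  have h := hstiff θ hθ
  have hcov : (phaseGauge fun x => Circle.exp (θ * χ x))ᴴ *
      ((bdgHopping fun x y => (t x y : ℂ) * Complex.exp (((θ * d x y : ℝ) : ℂ) * Complex.I)) + V) *
      phaseGauge (fun x => Circle.exp (θ * χ x)) =
      (bdgHopping fun x y => (t x y : ℂ) *
        Complex.exp (((θ * (d x y + (χ y - χ x)) : ℝ) : ℂ) * Complex.I)) + V := by
    rw [Matrix.mul_add, Matrix.add_mul,
      conjTranspose_phaseGauge_mul_bdgHopping_peierls_mul_phaseGauge t (fun x y => θ * d x y)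
        (fun x => θ * χ x), hVg]
    simp only [mul_add, mul_sub]
  rw [← partitionFn_toBlock_conjTranspose_phaseGauge_mul_mul_phaseGauge
    (fun x => Circle.exp (θ * χ x)) β
    ((bdgHopping fun x y => (t x y : ℂ) * Complex.exp (((θ * d x y : ℝ) : ℂ) * Complex.I)) + V) p,
    hcov] at h
  exact h

/-- **Edge**: the Kubo-curvature ceiling implies the landed thermal gauge-function stiffness
ceiling `ThermalStiffnessCeilingNumberConserving` (drop the nonnegative Duhamel term,
`IsHermitian.re_duhamel_self_nonneg`). -/
theorem thermalStiffnessCeilingNumberConserving_of_kubo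
    (h : ThermalKuboCurvatureCeilingNumberConservingGauge) :
    ThermalStiffnessCeilingNumberConserving := by
  intro Λ _ _ t d ht hd V hV hVg β hβ p _ _ ρ θ₀ hθ₀ hstiff χ
  obtain ⟨h1, -⟩ := h Λ t d ht hd V hV hVg β hβ p ρ θ₀ hθ₀ hstiff χ
  have hd' : ∀ x y, d y x + (χ x - χ y) = -(d x y + (χ y - χ x)) := fun x y => by
    rw [hd x y]; ring
  have hHp : ((bdgHopping (fun x y => (t x y : ℂ)) + V).toBlock p p).IsHermitian :=
    ((isHermitian_bdgHopping_real ht).add hV).submatrix _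
  have hJp : ((bdgHopping fun x y =>
      ((t x y * (d x y + (χ y - χ x)) : ℝ) : ℂ) * Complex.I).toBlock p p).IsHermitian :=
    (isHermitian_current (d := fun x y => d x y + (χ y - χ x)) ht hd').submatrix _
  have hnn := hHp.re_duhamel_self_nonneg hJp β
  nlinarith [mul_nonneg (div_nonneg hβ.le zero_le_two) hnn]

-- Re-proof of the landed node through the edge (consistency check; an `example`, not a named
-- theorem: the named form `thermalStiffnessCeilingNumberConserving_holds'` restated the landed
-- `thermalStiffnessCeilingNumberConserving_holds` and was flagged `dedup.landed` by the gate —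
-- lit g5 filing edit, statements of all nodes unchanged).
example : ThermalStiffnessCeilingNumberConserving :=
  thermalStiffnessCeilingNumberConserving_of_kubo
    thermalKuboCurvatureCeilingNumberConservingGauge_holds

end Proofs

end Summit.HubbardSuperconductivity.HubbardLadder.Bounds
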